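import Literature.Computability.AlgebraicComplexity.BurgisserRootCountGRHWeak
import Literature.Computability.AlgebraicComplexity.BurgisserThm45Proofs
import HarnessLib

/-!
# Discharge of Bürgisser's Theorem 4.1 (TCS 2000): `reduction_mod_primes_of_GRH_holds`

Topic `Literature/Computability/AlgebraicComplexity`; proof-only companion of
`BurgisserBooleanParts.lean` (it cannot live in that file: the proof imports files downstream of
it). The named fact `reduction_mod_primes_of_GRH` (Bürgisser, *Cook's versus Valiant's
hypothesis*, Theoret. Comput. Sci. 235 (2000), Thm. 4.1, p. 79, improving Koiran, *Hilbert's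
Nullstellensatz is in the polynomial hierarchy*, J. Complexity 12 (1996), Thm. 8: *assuming (GRH),
`π_S(x) ≥ π(x)/d^{O(n)} − O(x^{1/2} log(wx))` for every system `(S)` of integer polynomials of
degree `≤ d` in `n < d` unknowns and weight `≤ w` that is solvable over `ℂ`*) is now a THEOREM of
the tree. Bürgisser's proof (p. 84: "The proof of Theorem 4.1 follows now easily by combining
Theorem 4.5, Remark 4.6, and Corollary 4.8") is assembled from results all proved in the tree:

* **Thm. 4.5** (algebraic solutions of degree `d^{O(n)}` and logarithmic height `d^{O(n)} log w`):
  the named fact `algebraicSolution_height_bound`, discharged in `BurgisserThm45Proofs.lean`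
  (`algebraicSolution_height_bound_holds`);
* **Rem. 4.6 + a weak Cor. 4.8 under the (Dedekind) extended Riemann hypothesis** and the final
  bookkeeping: `reduction_mod_primes_of_GRH_of_heightBound` (`BurgisserRootCountGRHWeak.lean`),
  resting on the explicit-formula chain `DedekindZetaUniformBounds` → `DedekindZetaEntireConvexity`
  → `DedekindZetaLogDerivGRH` → `GRHChebyshevPsiLowerBound` → `GRHPrimeIdealCountLowerBound`
  (`Literature/NumberTheory/LFunctions/`), i.e. a GRH-conditional lower bound for the number of
  primes `p ≤ x` modulo which an irreducible `g ∈ ℤ[Y]` has a root.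

(An equivalent assembly through the full Cor. 4.8, `rootModPrimeCount_lower_bound_of_GRH_holds`
(`BurgisserRootCountGRHHolds.lean`) and `reduction_mod_primes_of_GRH_of_facts`
(`BurgisserReductionModPrimes.lean`), is also available in the tree; it is not imported here.)
This file contains no definitions.

## References

* P. Bürgisser, *Cook's versus Valiant's hypothesis*, Theoret. Comput. Sci. 235 (2000) 71–88,
  Thm. 4.1 p. 79, Thm. 4.5 p. 82, Rem. 4.6 p. 83, Cor. 4.8 and the proof of Thm. 4.1 p. 84.
  [Burgisser2000TCS]
* P. Koiran, *Hilbert's Nullstellensatz is in the polynomial hierarchy*, J. Complexity 12 (1996)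
  273–286, Thm. 8. [Koiran1996]
-/

namespace Literature.Computability.AlgebraicComplexity

/-- **Bürgisser 2000 TCS, Thm. 4.1 holds** (reduction of solvable integer systems modulo primes
under GRH; Koiran 1996, Thm. 8 in the sharpened form): the named fact `reduction_mod_primes_of_GRH`
is a theorem — Thm. 4.5 (`algebraicSolution_height_bound_holds`) fed into the proved glue
`reduction_mod_primes_of_GRH_of_heightBound` (Rem. 4.6 and a weak Cor. 4.8 under ERH, with the
bookkeeping of p. 84).
[cite: Burgisser2000TCS, Thm. 4.1 p. 79, proof p. 84] [cite: Koiran1996, Thm. 8] -/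
theorem reduction_mod_primes_of_GRH_holds : reduction_mod_primes_of_GRH :=
  reduction_mod_primes_of_GRH_of_heightBound algebraicSolution_height_bound_holds

end Literature.Computability.AlgebraicComplexity
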